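import Literature.ComputerArithmetic.Shewchuk1997.Compress
import Mathlib.Tactic.Linarith
import Mathlib.Tactic.Positivity
import Mathlib.Tactic.Ring
import Mathlib.Tactic.NormNum

/-!
# COMPRESS: the RELATIVE-error reading of Shewchuk's p.333 conjecture fails for round-to-nearest
# with an input-dependent tie rule (new work; a witness, checked)

New work of the certified-arithmetic venture (ENGINES group: shared numerical engines serving
client cells; rigour lives in the verifiers; every published number belongs to a client cell's
ledger, not to the engines group).  This file records NEGATIVE knowledge that fixes the unit in
which the sharp top-component error of COMPRESS is stated in this cluster.

Shewchuk [Shewchuk1997, §2.7 p. 333], after Theorem 23 (`|h − hₙ| < ulp(hₙ)`, formalised in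
`Literature/ComputerArithmetic/Shewchuk1997/Compress.lean`): "the bound for |h − hₙ| is not tight.
(I conjecture that the largest possible relative error is exhibited by a number that contains a
nonzero bit every pth bit; note that 1 + ½ulp(1) + ¼[ulp(1)]² + ··· cannot be further compressed.)"
With `ε = 2^-p` that number is `1 + ε + ε² + ⋯`; truncated after `k + 1` terms and with `hₙ = 1`, its
relative error is `(ε + ⋯ + ε^k)/(1 + ε + ⋯ + ε^k) < ε` (`every_pth_bit_relative_error_lt`, pure
arithmetic), so the conjecture read as a statement about RELATIVE error says `|h − hₙ| < ε·|h|`-ish,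
with supremum `ε` over the family.

Every theorem of this cluster is stated for an ARBITRARY round-to-nearest map `fl`
(`IsRoundNearest p emin fl`: `fl t ∈ F` is a nearest float, ANY tie-breaking, possibly depending on
the argument).  In that generality the relative reading is FALSE (`compress_relative_error_witness`):
with `p = 3` (so `ε = 1/8`), quantum exponent `emin = 0`, and the round-to-nearest map that is
round-to-nearest-even except that the two midpoints `72` and `−9` are sent to `80` and `−8`, COMPRESS
maps the nonoverlapping expansion `⟨−1, 8, 0, 0, 64⟩ = 71` to `⟨−1, −8, 80⟩`, whose largest component
`80` has relative error `9/71 > 1/8 = ε` — larger than that of every member of the conjectured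
extremal family.  (The witness was found by exhaustive search in an integer model of the tree's
`compress`; here it is replayed inside Lean: the seven roundings that occur are listed in
`compress_eval`.)  The ULP form of the conjecture — `|Σe − hₙ| ≤ ulp(hₙ)/2 · (1 + ε + ⋯ + ε^(k−1))`
for an output with `k` lower components, attained by the every-`p`th-bit numbers — is the statement
proved in this directory (`CompressSharpStair.lean`, `CompressCarryBound.lean`,
`CompressTopError.lean`); the witness attains it too: `|71 − 80| = 9 = ulp(80)/2 · (1 + ⅛)`
(`witness_attains_ulp_form`).

NOT CLAIMED: nothing here bears on the relative reading for ONE FIXED tie rule such as IEEE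
round-to-nearest-even (the witness breaks the tie at `72` upwards = to-odd and at `−9` towards zero =
to-even); exhaustive checks of small formats found no violation for a consistent rule, and that case
is left open.  HONEST FRAMING: Shewchuk states a conjecture, not a theorem; this file neither proves
nor refutes his sentence for his arithmetic (IEEE double, round-to-even) — it shows that the
any-tie-rule model used by this cluster cannot support the relative reading, which is why the sharp
bound is stated in ulps.
-/

namespace Summit.Ventures.CertifiedArithmetic.Expansions

open Literature.ComputerArithmetic.JeannerodRump2018
open Literature.ComputerArithmetic.BoldoJeannerodMelquiondMuller2023 hiding twoSum twoSum_fst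
open Literature.ComputerArithmetic.Shewchuk1997

/-! ### The conjectured extremal family: relative error below `ε = 2^-p` -/

/-- Shewchuk's number "that contains a nonzero bit every pth bit", `1 + ½ulp(1) + ¼ulp(1)² + ⋯`
truncated to `k + 1` terms, is `1 + ε + ⋯ + ε^k` with `ε = 2^-p` (`½ulp(1) = 2^-p`); taking
`hₙ = 1` (the number "cannot be further compressed"), its relative error
`(ε + ⋯ + ε^k) / (1 + ⋯ + ε^k)` is `< ε` for every `k` — so `ε` bounds the relative error of the
whole conjectured extremal family. Pure arithmetic. [cite: Shewchuk1997, §2.7 p. 333 (conjecture)] -/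
theorem every_pth_bit_relative_error_lt (p k : ℕ) :
    (Finset.range k).sum (fun i => (((2 : ℚ) ^ p)⁻¹) ^ (i + 1)) /
        (Finset.range (k + 1)).sum (fun i => (((2 : ℚ) ^ p)⁻¹) ^ i) < ((2 : ℚ) ^ p)⁻¹ := by
  set ε : ℚ := ((2 : ℚ) ^ p)⁻¹ with hε
  have hεpos : 0 < ε := by positivity
  have hden : 0 < (Finset.range (k + 1)).sum (fun i => ε ^ i) :=
    Finset.sum_pos (fun i _ => pow_pos hεpos i) ⟨0, by simp⟩
  rw [div_lt_iff₀ hden, Finset.mul_sum]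
  have hsplit : (Finset.range (k + 1)).sum (fun i => ε * ε ^ i) =
      (Finset.range k).sum (fun i => ε ^ (i + 1)) + ε ^ (k + 1) := by
    rw [Finset.sum_range_succ, pow_succ, mul_comm (ε ^ k)]
    congr 1
    exact Finset.sum_congr rfl (fun i _ => by ring)
  rw [hsplit]
  linarith [pow_pos hεpos (k + 1)]

/-! ### The binary format `F(3, 0)`: ulps and nearest floats around the two midpoints -/

/-- In precision `3` with quantum exponent `≥ 0`: `ulp(t) = 16` for `64 ≤ |t| ≤ 112` (sandwiched
between the floats `64 = 4·2⁴` and `112 = 7·2⁴`). [cite: BoldoEtAl2023, §2.1 Def. 2.1 (ulp)] -/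
private theorem ulp_eq_sixteen {t : ℚ} (h₁ : 64 ≤ |t|) (h₂ : |t| ≤ 112) : ulp 3 0 t = 16 := by
  have h64 : ulp 3 0 (((4 : ℤ) : ℚ) * 2 ^ (4 : ℤ)) = 2 ^ (4 : ℤ) :=
    ulp_int_mul_two_zpow (p := 3) (emin := 0) (by norm_num) (by norm_num) (by norm_num) (by norm_num)
      (Or.inl (by norm_num))
  have h112 : ulp 3 0 (((7 : ℤ) : ℚ) * 2 ^ (4 : ℤ)) = 2 ^ (4 : ℤ) :=
    ulp_int_mul_two_zpow (p := 3) (emin := 0) (by norm_num) (by norm_num) (by norm_num) (by norm_num)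
      (Or.inl (by norm_num))
  norm_num at h64 h112
  have hlo := ulp_mono (p := 3) (emin := 0) (show |(64 : ℚ)| ≤ |t| by rw [abs_of_pos (by norm_num)]; exact h₁)
  have hhi := ulp_mono (p := 3) (emin := 0) (h₂.trans (le_abs_self (112 : ℚ)))
  linarith

/-- In precision `3` with quantum exponent `≥ 0`: `ulp(t) = 2` for `8 ≤ |t| ≤ 14` (sandwiched between
the floats `8 = 4·2¹` and `14 = 7·2¹`). [cite: BoldoEtAl2023, §2.1 Def. 2.1 (ulp)] -/
private theorem ulp_eq_two {t : ℚ} (h₁ : 8 ≤ |t|) (h₂ : |t| ≤ 14) : ulp 3 0 t = 2 := by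
  have h8 : ulp 3 0 (((4 : ℤ) : ℚ) * 2 ^ (1 : ℤ)) = 2 ^ (1 : ℤ) :=
    ulp_int_mul_two_zpow (p := 3) (emin := 0) (by norm_num) (by norm_num) (by norm_num) (by norm_num)
      (Or.inl (by norm_num))
  have h14 : ulp 3 0 (((7 : ℤ) : ℚ) * 2 ^ (1 : ℤ)) = 2 ^ (1 : ℤ) :=
    ulp_int_mul_two_zpow (p := 3) (emin := 0) (by norm_num) (by norm_num) (by norm_num) (by norm_num)
      (Or.inl (by norm_num))
  norm_num at h8 h14
  have hlo := ulp_mono (p := 3) (emin := 0) (show |(8 : ℚ)| ≤ |t| by rw [abs_of_pos (by norm_num)]; exact h₁)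
  have hhi := ulp_mono (p := 3) (emin := 0) (h₂.trans (le_abs_self (14 : ℚ)))
  linarith

/-- `72` is a midpoint of `F(3, 0)`: its neighbours are `RD(72) = 64` and `RU(72) = 80`, so every float
is at distance `≥ 8` from it. [cite: BoldoEtAl2023, §2.2 (RD, RU), Property 2.9] -/
private theorem eight_le_abs_sub {f : ℚ} (hf : IsFloat 3 0 f) : 8 ≤ |72 - f| := by
  have hu : ulp 3 0 (72 : ℚ) = 16 :=
    ulp_eq_sixteen (by rw [abs_of_pos (by norm_num)]; norm_num) (by rw [abs_of_pos (by norm_num)]; norm_num)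
  rcases le_or_gt f 72 with h | h
  · have hRD := isRD_floor_mul_ulp (p := 3) (emin := 0) (by norm_num) (72 : ℚ)
    rw [hu, show ⌊(72 : ℚ) / 16⌋ = 4 by rw [Int.floor_eq_iff]; norm_num] at hRD
    have hle := hRD.le_of_isFloat_le hf h
    push_cast at hle
    rw [abs_of_nonneg (by linarith)]
    linarith
  · have hRU := isRU_ceil_mul_ulp (p := 3) (emin := 0) (by norm_num) (72 : ℚ)
    rw [hu, show ⌈(72 : ℚ) / 16⌉ = 5 by rw [Int.ceil_eq_iff]; norm_num] at hRU
    have hge := hRU.le_of_isFloat_ge hf h.le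
    push_cast at hge
    rw [abs_of_nonpos (by linarith)]
    linarith

/-- `−9` is a midpoint of `F(3, 0)`: its neighbours are `RD(−9) = −10` and `RU(−9) = −8`, so every
float is at distance `≥ 1` from it. [cite: BoldoEtAl2023, §2.2 (RD, RU), Property 2.9] -/
private theorem one_le_abs_sub {f : ℚ} (hf : IsFloat 3 0 f) : 1 ≤ |-9 - f| := by
  have hu : ulp 3 0 (-9 : ℚ) = 2 :=
    ulp_eq_two (by rw [abs_of_neg (by norm_num)]; norm_num) (by rw [abs_of_neg (by norm_num)]; norm_num)
  rcases le_or_gt f (-9) with h | h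
  · have hRD := isRD_floor_mul_ulp (p := 3) (emin := 0) (by norm_num) (-9 : ℚ)
    rw [hu, show ⌊(-9 : ℚ) / 2⌋ = -5 by rw [Int.floor_eq_iff]; norm_num] at hRD
    have hle := hRD.le_of_isFloat_le hf h
    push_cast at hle
    rw [abs_of_nonneg (by linarith)]
    linarith
  · have hRU := isRU_ceil_mul_ulp (p := 3) (emin := 0) (by norm_num) (-9 : ℚ)
    rw [hu, show ⌈(-9 : ℚ) / 2⌉ = -4 by rw [Int.ceil_eq_iff]; norm_num] at hRU
    have hge := hRU.le_of_isFloat_ge hf h.le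
    push_cast at hge
    rw [abs_of_nonpos (by linarith)]
    linarith

/-! ### Replaying COMPRESS on the witness -/

/-- The run of COMPRESS on `⟨−1, 8, 0, 0, 64⟩` (smallest first) under ANY map `fl` with the seven
listed values: first traversal `64 ⊕ 0 = 64` (twice, exact), `64 ⊕ 8 = fl 72 = 80` with roundoff
`−8` (emit `80`), `−8 ⊕ −1 = fl(−9) = −8` with roundoff `−1` (emit `−8`), bottom `−1`; second
traversal `−8 ⊕ −1 = −8`, roundoff `−1` (emit), `80 ⊕ −8 = 80`, roundoff `−8` (emit), top `80`.
An evaluation of the tree's model (`fastTwoSum` = FAST-TWO-SUM with its three roundings).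
[cite: Shewchuk1997, §2.7 p. 332 (COMPRESS)] -/
private theorem compress_eval {fl : ℚ → ℚ} (h0 : fl 0 = 0) (h1 : fl (-1) = -1) (h8 : fl (-8) = -8)
    (h16 : fl 16 = 16) (h64 : fl 64 = 64) (h72 : fl 72 = 80) (h9 : fl (-9) = -8) :
    compress fl [-1, 8, 0, 0, 64] = [-1, -8, 80] := by
  norm_num [compress, compressDown, compressUp, fastTwoSum, h0, h1, h8, h16, h64, h72, h9]

/-- The input `⟨−1, 8, 0, 0, 64⟩` consists of floats of `F(3, 0)`. [cite: Shewchuk1997, §2.1 p. 309] -/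
private theorem witness_isFloat : ∀ x ∈ ([-1, 8, 0, 0, 64] : List ℚ), IsFloat 3 0 x := by
  intro x hx
  simp only [List.mem_cons, List.mem_nil_iff, or_false] at hx
  rcases hx with rfl | rfl | rfl | rfl | rfl
  · exact ⟨-1, 0, by norm_num, le_rfl, by norm_num⟩
  · exact ⟨1, 3, by norm_num, by norm_num, by norm_num⟩
  · exact ⟨0, 0, by norm_num, le_rfl, by norm_num⟩
  · exact ⟨0, 0, by norm_num, le_rfl, by norm_num⟩
  · exact ⟨1, 6, by norm_num, by norm_num, by norm_num⟩

/-- The input `⟨−1, 8, 0, 0, 64⟩` is a nonoverlapping expansion, smallest component first, zeros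
allowed (`IsExpansion 1`). [cite: Shewchuk1997, §2.1 p. 309 (nonoverlapping), Theorem 23 hypotheses] -/
private theorem witness_isExpansion : IsExpansion 1 ([-1, 8, 0, 0, 64] : List ℚ) := by
  have b8 : ∀ x : ℚ, |x| < 8 → Below 1 x 8 := fun x hx => ⟨3, ⟨1, by norm_num⟩, by norm_num; exact hx⟩
  have b64 : ∀ x : ℚ, |x| < 64 → Below 1 x 64 := fun x hx => ⟨6, ⟨1, by norm_num⟩, by norm_num; exact hx⟩
  have b0 : ∀ x : ℚ, Below 1 x 0 := fun x => below_zero_right 1 x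
  refine List.Pairwise.cons ?_ (List.Pairwise.cons ?_ (List.Pairwise.cons ?_
    (List.Pairwise.cons ?_ (List.pairwise_singleton _ _))))
  · intro y hy
    simp only [List.mem_cons, List.mem_nil_iff, or_false] at hy
    rcases hy with rfl | rfl | rfl | rfl
    · exact b8 _ (by norm_num)
    · exact b0 _
    · exact b0 _
    · exact b64 _ (by norm_num)
  · intro y hy
    simp only [List.mem_cons, List.mem_nil_iff, or_false] at hy
    rcases hy with rfl | rfl | rfl
    · exact b0 _
    · exact b0 _
    · exact b64 _ (by norm_num)
  · intro y hy
    simp only [List.mem_cons, List.mem_nil_iff, or_false] at hy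
    rcases hy with rfl | rfl
    · exact b0 _
    · exact b64 _ (by norm_num)
  · intro y hy
    simp only [List.mem_cons, List.mem_nil_iff, or_false] at hy
    subst hy
    exact b64 _ (by norm_num)

/-! ### The witness -/

/-- **The relative reading of the p.333 conjecture fails for round-to-nearest with an input-dependent
tie rule.**  There is a round-to-nearest map `fl` on `F(3, 0)` (`IsRoundNearest 3 0 fl`: every `fl t`
is a float nearest to `t`) — namely round-to-nearest-even with the two midpoints `72 ↦ 80`, `−9 ↦ −8`
re-broken — under which COMPRESS sends the nonoverlapping expansion `⟨−1, 8, 0, 0, 64⟩ = 71` of floats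
to `⟨−1, −8, 80⟩`, whose largest component has RELATIVE error `|71 − 80|/71 = 9/71 > 1/8 = 2^-p` —
more than every member of the conjectured extremal family (`every_pth_bit_relative_error_lt`).
[cite: Shewchuk1997, §2.7 p. 333 (conjecture after Theorem 23); BoldoEtAl2023, §2.2 (round-to-nearest,
tie-breaking rules)] -/
theorem compress_relative_error_witness :
    ∃ fl : ℚ → ℚ, IsRoundNearest 3 0 fl ∧
      (∀ x ∈ ([-1, 8, 0, 0, 64] : List ℚ), IsFloat 3 0 x) ∧ IsExpansion 1 ([-1, 8, 0, 0, 64] : List ℚ) ∧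
      compress fl [-1, 8, 0, 0, 64] = [-1, -8, 80] ∧
      ((2 : ℚ) ^ 3)⁻¹ < |([-1, 8, 0, 0, 64] : List ℚ).sum - 80| / |([-1, 8, 0, 0, 64] : List ℚ).sum| := by
  obtain ⟨fl, hfl⟩ : ∃ fl : ℚ → ℚ,
      fl = fun t => if t = 72 then (80 : ℚ) else if t = -9 then -8 else roundTiesEven 3 0 t :=
    ⟨_, rfl⟩
  have h72 : fl 72 = 80 := by rw [hfl]; norm_num
  have h9 : fl (-9) = -8 := by rw [hfl]; norm_num
  have hother : ∀ t : ℚ, t ≠ 72 → t ≠ -9 → fl t = roundTiesEven 3 0 t := by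
    intro t ht ht'; rw [hfl]; simp [ht, ht']
  have hfix : ∀ t : ℚ, t ≠ 72 → t ≠ -9 → IsFloat 3 0 t → fl t = t := fun t ht ht' hF => by
    rw [hother t ht ht']; exact roundTiesEven_eq_self (by norm_num) hF
  have hRN : IsRoundNearest 3 0 fl := by
    intro t
    by_cases ht : t = 72
    · subst ht
      rw [h72]
      exact ⟨⟨5, 4, by norm_num, by norm_num, by norm_num⟩, fun f hf => by
        rw [show |(72 : ℚ) - 80| = 8 by norm_num]; exact eight_le_abs_sub hf⟩
    by_cases ht' : t = -9
    · subst ht'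
      rw [h9]
      exact ⟨⟨-1, 3, by norm_num, by norm_num, by norm_num⟩, fun f hf => by
        rw [show |(-9 : ℚ) - -8| = 1 by norm_num]; exact one_le_abs_sub hf⟩
    rw [hother t ht ht']
    exact isRoundNearest_roundTiesEven (p := 3) (emin := 0) (by norm_num) t
  refine ⟨fl, hRN, witness_isFloat, witness_isExpansion, ?_, by norm_num⟩
  exact compress_eval
    (hfix 0 (by norm_num) (by norm_num) ⟨0, 0, by norm_num, le_rfl, by norm_num⟩)
    (hfix (-1) (by norm_num) (by norm_num) ⟨-1, 0, by norm_num, le_rfl, by norm_num⟩)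
    (hfix (-8) (by norm_num) (by norm_num) ⟨-1, 3, by norm_num, by norm_num, by norm_num⟩)
    (hfix 16 (by norm_num) (by norm_num) ⟨1, 4, by norm_num, by norm_num, by norm_num⟩)
    (hfix 64 (by norm_num) (by norm_num) ⟨1, 6, by norm_num, by norm_num, by norm_num⟩)
    h72 h9

/-- Consistency with the ULP form proved in this directory (`CompressTopError.lean`: for an output with
`k` lower components, `|Σe − hₙ| ≤ ulp(hₙ)/2 · (1 + ε + ⋯ + ε^(k−1))`): the witness ATTAINS it —
`|71 − 80| = 9 = ulp(80)/2 · (1 + ⅛)` (`k = 2`, `ε = ⅛`, `ulp(80) = 16` in `F(3, 0)`).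
[cite: Shewchuk1997, §2.7 p. 333; BoldoEtAl2023, §2.1 (ulp)] -/
theorem witness_attains_ulp_form :
    |([-1, 8, 0, 0, 64] : List ℚ).sum - 80| = ulp 3 0 80 / 2 * (1 + ((2 : ℚ) ^ 3)⁻¹) := by
  rw [ulp_eq_sixteen (by rw [abs_of_pos (by norm_num)]; norm_num) (by rw [abs_of_pos (by norm_num)]; norm_num)]
  norm_num

end Summit.Ventures.CertifiedArithmetic.Expansions
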